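/-
Copyright (c) 2026 the pub-hodgecm-mathlib formalisation cell (harness21).  Prover seat hodgecm-mathlib-K2E3-p11 (g5), Track B «K2-LIT» ∕ h413
(`stmt-HodgeConjecture-24833`), line `K2_E3_EllipticInputs`, road «GL-[M6]-sc» brick T15-log (MIXED HALF), FILE M3a: the elementary kit — the characteristic
polynomial of the parabolic slice `P(r)`, the rearrangement bound `∫_{𝔭ⁿ} ‖c + λy‖^{-s} dy ≤ ‖λ‖^{-s} ∫_{𝔭ⁿ} ‖y‖^{-s}`, and the two-variable peeling on `F⁷`.  2026-09-04.
-/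
import Summits.HodgeConjecture.HodgeConjecture.Theorems.K2E3GL3SplitDiscriminantBoxIntegral   -- ★ K2E3-p17 (g7): `lintegral_indicator_primePowBall_comp_sub` (translation inside a ball)
import Summits.HodgeConjecture.HodgeConjecture.Theorems.K2E3CubicDiscDerivativeBound         -- ★ K2E3-p03 (g4): `discr_eq_derivative_sq_mul_of_isRoot`
import Summits.HodgeConjecture.HodgeConjecture.Theorems.K2E3GL3SimpleEigenvalueLeviForm        -- ★ S″ (K2E3-p03): `charpoly_eq_of_col_two_eq_zero`
import Summits.HodgeConjecture.HodgeConjecture.Theorems.K2E3GL3ParabolicNilTwist               -- ★ A′ (K2E3-p21): `eval_charpoly_fin_two`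
import Literature.LinearAlgebra.Matrix.CharpolyFactorDatumProper                             -- ★ `charpoly_two_mul_X_sub_C_coeff`
import Literature.NumberTheory.Automorphic.LocalFieldHaarNegPower                            -- ★ `lintegral_coe_normAbs_rpow_neg_lt_top`
import Mathlib.MeasureTheory.Integral.Marginal
import HarnessLib

/-!
# K2_E3 road (h413), «GL-[M6]-sc» brick T15-log (mixed half), FILE M3a — slice algebra, the rearrangement bound, the two-variable peeling

Cell `pub/hodgecm-mathlib` (D-0151), Track B, seat K2E3-p11 (g5) (T15-log MIXED HALF, `K2/STATUS.md` 2026-09-04 07:18:47Z; road owner K2E3-p23 (g5)).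
`--supports stmt-HodgeConjecture-24833 --as helper`; THEOREMS ONLY (no definition ∕ instance ∕ notation ∕ named fact ∕ `sorry`); never imports `Cruxes/…/Lines`.
COUNT-NEUTRAL.

CONTENTS (everything the mixed half of Harish-Chandra's Theorem 15 on `𝔤𝔩₃(F)` needs besides ★ (3E)).  `P(r) = [[r₀,r₁,r₂],[r₃,r₄,r₅],[0,0,r₆]]`, `A(r) = [[r₀,r₁],[r₃,r₄]]`.
* §1 `charpoly_parabolic` (`χ_{P(r)} = χ_{A(r)}·(X − r₆)`), `derivative_charpoly_parabolic_eval` (`χ'_{P(r)}(r₆) = χ_{A(r)}(r₆) = (r₆−r₀)(r₆−r₄) − r₁r₃`),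
  `discr_charpoly_two` (`disc χ_{A(r)} = (r₀−r₄)² + 4r₃r₁`), **`discr_charpoly_parabolic`** (`disc χ_{P(r)} = χ_{A(r)}(r₆)² · disc χ_{A(r)}`, via ★ W-BOUND's
  `discr_eq_derivative_sq_mul_of_isRoot`).
* §2 the REARRANGEMENT BOUND `setLIntegral_primePowBall_normAbs_add_rpow_neg_le` (`∫_{𝔭ⁿ} ‖c + y‖^{-s} ≤ ∫_{𝔭ⁿ} ‖y‖^{-s}` for EVERY `c ∈ F`: equality by translation if
  `c ∈ 𝔭ⁿ`, else `‖c + y‖ = ‖c‖ ≥ ‖y‖` pointwise) and its affine form `…_affine_…` (`∫_{𝔭ⁿ} ‖c + λy‖^{-s} ≤ ‖λ‖^{-s} ∫_{𝔭ⁿ} ‖y‖^{-s}`, `λ ≠ 0`).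
* §3 **`lintegral_pi_restrict_normAbs_affine_rpow_neg_le`** ∕ `_lt_top`: on the box `(𝔭ⁿ)⁷`, `∫ ‖c(r) + κ₀ r₃ r₁‖^{-s} dr ≤ ‖κ₀‖^{-s} (1 + I)² vol(𝔭ⁿ)⁵ < ∞` for `c`
  measurable and independent of `r₁`, `κ₀ ≠ 0`, `0 < s < 1`, `I = ∫_{𝔭ⁿ} ‖u‖^{-s}` (peel `r₁` by §2, then `r₃`; Mathlib `lmarginal`).
[HarishChandra1970, Part VII §3 Thm. 15 p. 72] [Tate1950, §2.2 Lemma 2.2.5, §2.4] [WeilBNT1967, Ch. I §2]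
HONEST LABEL: HC_CM is proved only modulo the 7 printed citations (2 remaining named inputs: hLiu418 = stmt-HodgeConjecture-24832, h413 =
stmt-HodgeConjecture-24833) until rung 0 closes; count-neutral helper.

## References
* [HarishChandra1970] Harish-Chandra (van Dijk), *Harmonic Analysis on Reductive p-adic Groups*, LNM 162 (1970), Part VII §3 Thm. 15.
* [Tate1950] J. Tate, *Fourier analysis in number fields and Hecke's zeta-functions* (1950), §2.2, §2.4.
* [WeilBNT1967] A. Weil, *Basic Number Theory* (1967), Ch. I §2, §4.
-/

set_option autoImplicit false
set_option linter.dupNamespace false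

noncomputable section

open MeasureTheory Measure Filter Topology Set Matrix Polynomial
open scoped MatrixGroups NNReal ENNReal
open Literature.NumberTheory.Automorphic Literature.NumberTheory.Automorphic.LocalFieldHaar
open Literature.NumberTheory.GaloisRepresentations Literature.NumberTheory.GaloisRepresentations.IsNonarchimedeanLocalField

namespace Summit.HodgeConjecture.HodgeConjecture.Cruxes.H413.K2E3GL3ParabolicSliceRpowNegKit

/-! ## §1  The characteristic polynomial of the parabolic slice -/

section Algebra

variable {R : Type*} [CommRing R]

/-- `χ_{P(r)} = χ_{A(r)} · (X − r₆)` for `P(r) = [[r₀,r₁,r₂],[r₃,r₄,r₅],[0,0,r₆]]`, `A(r) = [[r₀,r₁],[r₃,r₄]]` (block-triangular; transpose of ★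
`charpoly_eq_of_col_two_eq_zero`). [cite: Rogawski1990, §4.3 p. 42] -/
theorem charpoly_parabolic (r : Fin 7 → R) :
    ((!![r 0, r 1, r 2; r 3, r 4, r 5; 0, 0, r 6] : Matrix (Fin 3) (Fin 3) R)).charpoly =
      ((!![r 0, r 1; r 3, r 4] : Matrix (Fin 2) (Fin 2) R)).charpoly * (X - C (r 6)) := by
  rw [← Matrix.charpoly_transpose ((!![r 0, r 1, r 2; r 3, r 4, r 5; 0, 0, r 6] : Matrix (Fin 3) (Fin 3) R))]
  have h := K2E3GL3SimpleEigenvalueLeviForm.charpoly_eq_of_col_two_eq_zero ((!![r 0, r 1, r 2; r 3, r 4, r 5; 0, 0, r 6] : Matrix (Fin 3) (Fin 3) R))ᵀ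
    (by simp) (by simp)
  rw [h, ← Matrix.charpoly_transpose ((!![r 0, r 1; r 3, r 4] : Matrix (Fin 2) (Fin 2) R))]
  congr 2
  ext i j; fin_cases i <;> fin_cases j <;> simp

/-- `χ_{A(r)}(r₆) = (r₆ − r₀)(r₆ − r₄) − r₁ r₃` (★ `eval_charpoly_fin_two`). [cite: Rogawski1990, §4.3 p. 42] -/
theorem eval_charpoly_two (r : Fin 7 → R) :
    ((!![r 0, r 1; r 3, r 4] : Matrix (Fin 2) (Fin 2) R)).charpoly.eval (r 6) = (r 6 - r 0) * (r 6 - r 4) - r 1 * r 3 :=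
  K2E3GL3ParabolicNilTwist.eval_charpoly_fin_two ![r 0, r 1, r 3, r 4, r 6]

/-- `χ'_{P(r)}(r₆) = χ_{A(r)}(r₆) = (r₆ − r₀)(r₆ − r₄) − r₁ r₃` (product rule at the root `r₆` of the linear factor). [cite: Rogawski1990, §4.3 p. 42] -/
theorem derivative_charpoly_parabolic_eval (r : Fin 7 → R) :
    ((!![r 0, r 1, r 2; r 3, r 4, r 5; 0, 0, r 6] : Matrix (Fin 3) (Fin 3) R)).charpoly.derivative.eval (r 6) = (r 6 - r 0) * (r 6 - r 4) - r 1 * r 3 := by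
  rw [charpoly_parabolic, ← eval_charpoly_two r]
  set g := ((!![r 0, r 1; r 3, r 4] : Matrix (Fin 2) (Fin 2) R)).charpoly with hg
  simp only [derivative_mul, derivative_sub, derivative_X, derivative_C, sub_zero, mul_one, eval_add, eval_mul, eval_sub, eval_X, eval_C,
    sub_self, mul_zero, zero_add]

/-- `disc χ_{A(r)} = (r₀ − r₄)² + 4 r₃ r₁` (`= tr² − 4 det`, Mathlib `discr_of_degree_eq_two` in coefficient language). [cite: Rogawski1990, §4.3 p. 42] -/
theorem discr_charpoly_two (r : Fin 7 → R) :
    ((!![r 0, r 1; r 3, r 4] : Matrix (Fin 2) (Fin 2) R)).charpoly.discr = (r 0 - r 4) ^ 2 + 4 * r 3 * r 1 := by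
  have h : ((!![r 0, r 1; r 3, r 4] : Matrix (Fin 2) (Fin 2) R)).charpoly.discr =
      ((!![r 0, r 1; r 3, r 4] : Matrix (Fin 2) (Fin 2) R)).trace ^ 2 - 4 * ((!![r 0, r 1; r 3, r 4] : Matrix (Fin 2) (Fin 2) R)).det :=
    Matrix.discr_fin_two _
  rw [h, Matrix.trace_fin_two, Matrix.det_fin_two]
  simp only [Matrix.of_apply, Matrix.cons_val', Matrix.cons_val_zero, Matrix.cons_val_one, Matrix.cons_val_fin_one]
  ring

variable [Nontrivial R]


/-- **`disc χ_{P(r)} = χ_{A(r)}(r₆)² · disc χ_{A(r)}`** — the discriminant of `χ_A·(X − a)` is `χ_A(a)²·disc χ_A` (★ W-BOUND `discr_eq_derivative_sq_mul_of_isRoot` at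
the root `r₆`, and the coefficients of `χ_A·(X − r₆)` from ★ `charpoly_two_mul_X_sub_C_coeff`). [cite: Rogawski1990, §4.3 p. 42] -/
theorem discr_charpoly_parabolic (r : Fin 7 → R) :
    ((!![r 0, r 1, r 2; r 3, r 4, r 5; 0, 0, r 6] : Matrix (Fin 3) (Fin 3) R)).charpoly.discr =
      ((r 6 - r 0) * (r 6 - r 4) - r 1 * r 3) ^ 2 * ((r 0 - r 4) ^ 2 + 4 * r 3 * r 1) := by
  set f := ((!![r 0, r 1, r 2; r 3, r 4, r 5; 0, 0, r 6] : Matrix (Fin 3) (Fin 3) R)).charpoly with hf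
  set g := ((!![r 0, r 1; r 3, r 4] : Matrix (Fin 2) (Fin 2) R)).charpoly with hg
  have hmon : f.Monic := Matrix.charpoly_monic _
  have hdeg : f.natDegree = 3 := by rw [hf, Matrix.charpoly_natDegree_eq_dim, Fintype.card_fin]
  have hder : f.derivative.eval (r 6) = (r 6 - r 0) * (r 6 - r 4) - r 1 * r 3 := derivative_charpoly_parabolic_eval r
  have hfg : f = g * (X - C (r 6)) := charpoly_parabolic r
  have hroot : f.IsRoot (r 6) := by rw [IsRoot, hfg, eval_mul, eval_sub, eval_X, eval_C, sub_self, mul_zero]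
  have hgmon : g.Monic := Matrix.charpoly_monic _
  have hgdeg : g.natDegree = 2 := by rw [hg, Matrix.charpoly_natDegree_eq_dim, Fintype.card_fin]
  have hg2 : g.coeff 2 = 1 := by rw [← hgdeg]; exact hgmon.coeff_natDegree
  obtain ⟨-, h1, h2⟩ := Literature.LinearAlgebra.Matrix.charpoly_two_mul_X_sub_C_coeff
    ((!![r 0, r 1; r 3, r 4] : Matrix (Fin 2) (Fin 2) R)) (r 6)
  have hdg : g.discr = (r 0 - r 4) ^ 2 + 4 * r 3 * r 1 := discr_charpoly_two r
  have hdg' : g.discr = g.coeff 1 ^ 2 - 4 * g.coeff 0 * g.coeff 2 :=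
    discr_of_degree_eq_two (by rw [degree_eq_natDegree hgmon.ne_zero, hgdeg]; norm_cast)
  have hcoef : f.coeff 2 ^ 2 - 2 * f.coeff 2 * r 6 - 3 * r 6 ^ 2 - 4 * f.coeff 1 = (r 0 - r 4) ^ 2 + 4 * r 3 * r 1 := by
    rw [hfg, h1, h2, ← hdg, hdg', hg2]
    ring
  rw [K2E3CubicDiscDerivativeBound.discr_eq_derivative_sq_mul_of_isRoot hmon hdeg hroot, hder, hcoef]

end Algebra

/-! ## §2  The rearrangement bound `∫_{𝔭ⁿ} ‖c + λ y‖^{-s} ≤ ‖λ‖^{-s} ∫_{𝔭ⁿ} ‖y‖^{-s}` -/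

section Local

variable {F : Type*} [Field F] [ValuativeRel F] [TopologicalSpace F] [IsNonarchimedeanLocalField F]

/-- `x ≤ y ⇒ y^z ≤ x^z` in `ℝ≥0∞` for `z ≤ 0`. [folklore] -/
theorem ennreal_rpow_le_rpow_of_nonpos {x y : ℝ≥0∞} (hxy : x ≤ y) {z : ℝ} (hz : z ≤ 0) : y ^ z ≤ x ^ z := by
  have h : x ^ (-z) ≤ y ^ (-z) := ENNReal.monotone_rpow_of_nonneg (neg_nonneg.2 hz) hxy
  have e : ∀ w : ℝ≥0∞, w ^ z = (w ^ (-z))⁻¹ := fun w => by rw [← ENNReal.rpow_neg, neg_neg]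
  rw [e x, e y]
  exact ENNReal.inv_le_inv' h

variable [MeasurableSpace F] [BorelSpace F] (dx : Measure F) [dx.IsAddHaarMeasure]

/-- **REARRANGEMENT**: `∫_{𝔭ⁿ} ‖c + y‖^{-s} dy ≤ ∫_{𝔭ⁿ} ‖y‖^{-s} dy` for every `c ∈ F` and `s ≥ 0` — equality by translation if `c ∈ 𝔭ⁿ` (★ p17's
`lintegral_indicator_primePowBall_comp_sub`), and if `c ∉ 𝔭ⁿ` then `‖c + y‖ = ‖c‖ ≥ ‖y‖` on `𝔭ⁿ`. [cite: Tate1950, §2.4] [cite: WeilBNT1967, Ch. I §2] -/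
theorem setLIntegral_primePowBall_normAbs_add_rpow_neg_le (c : F) {s : ℝ} (hs : 0 ≤ s) (n : ℤ) :
    ∫⁻ y in primePowBall F n, ((normAbs F (c + y) : ℝ≥0∞)) ^ (-s) ∂dx ≤ ∫⁻ y in primePowBall F n, ((normAbs F y : ℝ≥0∞)) ^ (-s) ∂dx := by
  by_cases hc : c ∈ primePowBall F n
  · have hc' : -c ∈ primePowBall F n := by rw [mem_primePowBall_iff, normAbs_neg]; exact mem_primePowBall_iff.1 hc
    have h := K2E3GL3SplitDiscriminantBoxIntegral.lintegral_indicator_primePowBall_comp_sub dx hc' fun u => ((normAbs F u : ℝ≥0∞)) ^ (-s)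
    rw [← h, ← lintegral_indicator (measurableSet_primePowBall n)]
    refine le_of_eq (lintegral_congr fun y => ?_)
    by_cases hy : y ∈ primePowBall F n
    · rw [indicator_of_mem hy, indicator_of_mem hy, sub_neg_eq_add, add_comm]
    · rw [indicator_of_notMem hy, indicator_of_notMem hy]
  · refine setLIntegral_mono' (measurableSet_primePowBall n) fun y hy => ?_
    have hlt : normAbs F y < normAbs F c := lt_of_le_of_lt (mem_primePowBall_iff.1 hy) (not_le.1 fun h => hc (mem_primePowBall_iff.2 h))
    rw [normAbs_add_eq_of_lt hlt]
    exact ennreal_rpow_le_rpow_of_nonpos (ENNReal.coe_le_coe.2 hlt.le) (neg_nonpos.2 hs)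

/-- **AFFINE REARRANGEMENT**: `∫_{𝔭ⁿ} ‖c + λ y‖^{-s} dy ≤ ‖λ‖^{-s} · ∫_{𝔭ⁿ} ‖y‖^{-s} dy` for `λ ≠ 0`, every `c ∈ F`, `s ≥ 0` (`c + λy = λ(λ⁻¹c + y)`).
[cite: Tate1950, §2.4] [cite: WeilBNT1967, Ch. I §2] -/
theorem setLIntegral_primePowBall_normAbs_affine_rpow_neg_le {l : F} (hl : l ≠ 0) (c : F) {s : ℝ} (hs : 0 ≤ s) (n : ℤ) :
    ∫⁻ y in primePowBall F n, ((normAbs F (c + l * y) : ℝ≥0∞)) ^ (-s) ∂dx ≤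
      ((normAbs F l : ℝ≥0∞)) ^ (-s) * ∫⁻ y in primePowBall F n, ((normAbs F y : ℝ≥0∞)) ^ (-s) ∂dx := by
  have hpt : ∀ y, ((normAbs F (c + l * y) : ℝ≥0∞)) ^ (-s) = ((normAbs F l : ℝ≥0∞)) ^ (-s) * ((normAbs F (l⁻¹ * c + y) : ℝ≥0∞)) ^ (-s) := by
    intro y
    rw [show c + l * y = l * (l⁻¹ * c + y) by rw [mul_add, mul_inv_cancel_left₀ hl], map_mul, ENNReal.coe_mul,
      ENNReal.mul_rpow_of_ne_top ENNReal.coe_ne_top ENNReal.coe_ne_top]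
  simp_rw [hpt]
  have hltop : ((normAbs F l : ℝ≥0∞)) ^ (-s) ≠ ⊤ :=
    ENNReal.rpow_ne_top_of_nonneg' (ENNReal.coe_pos.2 (pos_iff_ne_zero.2 ((map_ne_zero (normAbs F)).2 hl))) ENNReal.coe_ne_top
  rw [lintegral_const_mul' _ _ hltop]
  exact mul_le_mul' le_rfl (setLIntegral_primePowBall_normAbs_add_rpow_neg_le dx (l⁻¹ * c) hs n)

/-! ## §3  The two-variable peeling on the box `(𝔭ⁿ)⁷` -/

set_option maxHeartbeats 800000 in
/-- **PEELING `r₁` THEN `r₃`.**  On the box `(𝔭ⁿ)⁷` (product of the restricted measures `dx|_{𝔭ⁿ}`), for `c : F⁷ → F` measurable and independent of the coordinate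
`1`, `κ₀ ≠ 0` and `0 < s`:  `∫ ‖c(r) + κ₀ r₃ r₁‖^{-s} dr ≤ ‖κ₀‖^{-s} · (1 + I)² · dx(𝔭ⁿ)⁵`, `I = ∫_{𝔭ⁿ} ‖u‖^{-s} du` (§2 in `r₁` with `λ = κ₀ r₃`, then
`∫_{𝔭ⁿ} ‖κ₀ u‖^{-s} du = ‖κ₀‖^{-s} I`; Mathlib `lmarginal`). [cite: HarishChandra1970, Part VII §3 Thm. 15 p. 72] [cite: Tate1950, §2.4] -/
theorem lintegral_pi_restrict_normAbs_affine_rpow_neg_le (n : ℤ) {s : ℝ} (hs : 0 < s) {κ₀ : F} (hκ : κ₀ ≠ 0)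
    {c : (Fin 7 → F) → F} (hcm : Measurable c) (hc1 : ∀ r t, c (Function.update r 1 t) = c r) :
    ∫⁻ r, ((normAbs F (c r + κ₀ * r 3 * r 1) : ℝ≥0∞)) ^ (-s) ∂(Measure.pi fun _ : Fin 7 => dx.restrict (primePowBall F n)) ≤
      ((normAbs F κ₀ : ℝ≥0∞)) ^ (-s) * (1 + ∫⁻ u in primePowBall F n, ((normAbs F u : ℝ≥0∞)) ^ (-s) ∂dx) ^ 2 * (dx (primePowBall F n)) ^ 5 := by
  classical
  haveI : T2Space F := (isLocalField F).toT2Space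
  haveI : LocallyCompactSpace F := (isLocalField F).toLocallyCompactSpace
  haveI : SecondCountableTopology F := secondCountableTopology_localField F
  haveI : IsTopologicalRing F := inferInstance
  set B : Set F := primePowBall F n with hB
  have hBm : MeasurableSet B := measurableSet_primePowBall n
  have hBfin : dx B < ∞ := measure_primePowBall_lt_top dx n
  set ν : Measure F := dx.restrict B with hν
  haveI : IsFiniteMeasure ν := ⟨by rw [hν, Measure.restrict_apply_univ]; exact hBfin⟩
  set I : ℝ≥0∞ := ∫⁻ u in B, ((normAbs F u : ℝ≥0∞)) ^ (-s) ∂dx with hI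
  set Φ : (Fin 7 → F) → ℝ≥0∞ := fun r => ((normAbs F (c r + κ₀ * r 3 * r 1) : ℝ≥0∞)) ^ (-s) with hΦ
  have hΦm : Measurable Φ :=
    (measurable_normAbs.comp (hcm.add ((measurable_const.mul (measurable_pi_apply 3)).mul (measurable_pi_apply 1)))).coe_nnreal_ennreal.pow_const _
  -- peel `r₁`
  set G₁ : (Fin 7 → F) → ℝ≥0∞ := fun r => ((normAbs F (κ₀ * r 3) : ℝ≥0∞)) ^ (-s) * (1 + I) with hG₁
  have hG₁m : Measurable G₁ := ((measurable_normAbs.comp (measurable_const.mul (measurable_pi_apply 3))).coe_nnreal_ennreal.pow_const _).mul_const _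
  have h31 : (3 : Fin 7) ≠ 1 := by decide
  have hstep1 : ∀ r : Fin 7 → F, ∫⁻ t, Φ (Function.update r 1 t) ∂ν ≤ G₁ r := by
    intro r
    have hupd : ∀ t, Φ (Function.update r 1 t) = ((normAbs F (c r + (κ₀ * r 3) * t) : ℝ≥0∞)) ^ (-s) := by
      intro t
      simp only [hΦ, hc1, Function.update_self, Function.update_of_ne h31, mul_assoc]
    simp_rw [hupd]
    by_cases h3 : r 3 = 0
    · have h0 : ((normAbs F (κ₀ * r 3) : ℝ≥0∞)) ^ (-s) = ⊤ := by
        rw [h3, mul_zero, map_zero, ENNReal.coe_zero, ENNReal.zero_rpow_of_neg (neg_neg_of_pos hs)]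
      rw [hG₁]
      simp only
      rw [h0, ENNReal.top_mul (by positivity)]
      exact le_top
    · have hl : κ₀ * r 3 ≠ 0 := mul_ne_zero hκ h3
      calc ∫⁻ t, ((normAbs F (c r + (κ₀ * r 3) * t) : ℝ≥0∞)) ^ (-s) ∂ν
          ≤ ((normAbs F (κ₀ * r 3) : ℝ≥0∞)) ^ (-s) * I := setLIntegral_primePowBall_normAbs_affine_rpow_neg_le dx hl (c r) hs.le n
        _ ≤ G₁ r := mul_le_mul' le_rfl le_add_self
  -- peel `r₃`
  set K : ℝ≥0∞ := ((normAbs F κ₀ : ℝ≥0∞)) ^ (-s) * (1 + I) ^ 2 with hK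
  have hstep2 : ∀ r : Fin 7 → F, ∫⁻ u, G₁ (Function.update r 3 u) ∂ν ≤ K := by
    intro r
    have hupd : ∀ u, G₁ (Function.update r 3 u) = (((normAbs F κ₀ : ℝ≥0∞)) ^ (-s) * (1 + I)) * ((normAbs F u : ℝ≥0∞)) ^ (-s) := by
      intro u
      simp only [hG₁, Function.update_self]
      rw [map_mul, ENNReal.coe_mul, ENNReal.mul_rpow_of_ne_top ENNReal.coe_ne_top ENNReal.coe_ne_top]
      ring
    simp_rw [hupd]
    rw [lintegral_const_mul _ (measurable_normAbs.coe_nnreal_ennreal.pow_const _)]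
    calc ((normAbs F κ₀ : ℝ≥0∞)) ^ (-s) * (1 + I) * ∫⁻ u, ((normAbs F u : ℝ≥0∞)) ^ (-s) ∂ν
        ≤ ((normAbs F κ₀ : ℝ≥0∞)) ^ (-s) * (1 + I) * (1 + I) := mul_le_mul' le_rfl le_add_self
      _ = K := by rw [hK]; ring
  -- assemble with `lmarginal`
  have huniv : (Finset.univ : Finset (Fin 7)) = insert 1 (insert 3 ({0, 2, 4, 5, 6} : Finset (Fin 7))) := by decide
  have h1 : (1 : Fin 7) ∉ (insert 3 ({0, 2, 4, 5, 6} : Finset (Fin 7))) := by decide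
  have h3 : (3 : Fin 7) ∉ ({0, 2, 4, 5, 6} : Finset (Fin 7)) := by decide
  set x₀ : Fin 7 → F := fun _ => 0 with hx₀
  rw [lintegral_eq_lmarginal_univ x₀, huniv, lmarginal_insert' _ hΦm h1]
  calc (∫⋯∫⁻_insert 3 ({0, 2, 4, 5, 6} : Finset (Fin 7)), (fun r => ∫⁻ t, Φ (Function.update r 1 t) ∂ν) ∂fun _ : Fin 7 => ν) x₀
      ≤ (∫⋯∫⁻_insert 3 ({0, 2, 4, 5, 6} : Finset (Fin 7)), G₁ ∂fun _ : Fin 7 => ν) x₀ := lmarginal_mono (fun r => hstep1 r) x₀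
    _ = (∫⋯∫⁻_({0, 2, 4, 5, 6} : Finset (Fin 7)), (fun r => ∫⁻ u, G₁ (Function.update r 3 u) ∂ν) ∂fun _ : Fin 7 => ν) x₀ := by
        rw [lmarginal_insert' _ hG₁m h3]
    _ ≤ (∫⋯∫⁻_({0, 2, 4, 5, 6} : Finset (Fin 7)), (fun _ => K) ∂fun _ : Fin 7 => ν) x₀ := lmarginal_mono (fun r => hstep2 r) x₀
    _ = K * (dx B) ^ 5 := by
        simp only [lmarginal, lintegral_const, Measure.pi_univ, Finset.prod_const, hν, Measure.restrict_apply_univ]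
        congr 1
    _ = ((normAbs F κ₀ : ℝ≥0∞)) ^ (-s) * (1 + I) ^ 2 * (dx B) ^ 5 := by rw [hK]

/-- **… AND IT IS FINITE for `0 < s < 1`** (★ `lintegral_coe_normAbs_rpow_neg_lt_top`). [cite: HarishChandra1970, Part VII §3 Thm. 15 p. 72] [cite: Tate1950, §2.4] -/
theorem lintegral_pi_restrict_normAbs_affine_rpow_neg_lt_top (n : ℤ) {s : ℝ} (hs : 0 < s) (hs1 : s < 1) {κ₀ : F} (hκ : κ₀ ≠ 0)
    {c : (Fin 7 → F) → F} (hcm : Measurable c) (hc1 : ∀ r t, c (Function.update r 1 t) = c r) :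
    ∫⁻ r, ((normAbs F (c r + κ₀ * r 3 * r 1) : ℝ≥0∞)) ^ (-s) ∂(Measure.pi fun _ : Fin 7 => dx.restrict (primePowBall F n)) < ∞ := by
  refine (lintegral_pi_restrict_normAbs_affine_rpow_neg_le dx n hs hκ hcm hc1).trans_lt ?_
  have hκ' : ((normAbs F κ₀ : ℝ≥0∞)) ^ (-s) ≠ ⊤ :=
    ENNReal.rpow_ne_top_of_nonneg' (ENNReal.coe_pos.2 (pos_iff_ne_zero.2 ((map_ne_zero (normAbs F)).2 hκ))) ENNReal.coe_ne_top
  have hI : (1 + ∫⁻ u in primePowBall F n, ((normAbs F u : ℝ≥0∞)) ^ (-s) ∂dx) ^ 2 ≠ ⊤ :=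
    ENNReal.pow_ne_top (ENNReal.add_ne_top.2 ⟨ENNReal.one_ne_top, (lintegral_coe_normAbs_rpow_neg_lt_top dx hs1 n).ne⟩)
  exact ENNReal.mul_lt_top (ENNReal.mul_lt_top hκ'.lt_top hI.lt_top) (ENNReal.pow_lt_top (measure_primePowBall_lt_top dx n))

end Local

end Summit.HodgeConjecture.HodgeConjecture.Cruxes.H413.K2E3GL3ParabolicSliceRpowNegKit

end
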